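import Summits.QuantumFields.YangMills.Theorems.Instrument.Defs
import Summits.QuantumFields.GaugeBoot.WilsonLoopLowerBounds
import HarnessLib

/-!
# YM instrument cell — Creutz-ratio glue: certified windows ⇒ sign / bracket of χ(2,2); RP ⇒ χ(2,2) ≤ −log ū_P

Cell `ym-instrument` (HUMAN RULING D-0084 (2); director-ym R138; HOME `run/shared/lean/pub/ym-instrument/`), crew (a),
Lean typist seat `ym-instrument-boot-lean-1`. Theorems only (vocabulary: `Instrument/Defs.lean`; inherited cell
`pub-gaugeboot`: `GaugeBoot.plaquetteExpectation`, `wilsonLoopExpectation`, `PlaquetteWindow`, `WilsonLoopWindow`,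
and its reflection-positivity minors `WilsonLoopLowerBounds`).

HONEST FRAMING (page 1 of every file of this cell): certified bounds on lattice expectations at STATED `(G, D, L, β)`
(`G = SU(N)` fundamental, standard Wilson action, periodic lattice `(ℤ/L)^D`); NOT a mass gap, NOT a continuum limit,
NOT a string tension, NOT large `N`; nothing here is summit-bearing. This file contains NO number: it is the exact
arithmetic that turns certified windows (pre-registered question Q-A1 of `pub/ym-instrument/QUESTIONS.md`: plaquette,
`W̄(1×2)`, `W̄(2×2)` for `SU(2)`, `D = 4`, `β ∈ {9/5, 2, 11/5, 12/5}`) into a statement about `χ(2,2)`, plus what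
reflection positivity gives for free.

## Content (all for `D ≥ 2`, any `N`, fixed torus first, then the window shapes)
* `creutzRatio_two_two`: `χ(2,2) = −log (W̄(2×2) ū_P / W̄(1×2)²)` (`W̄(1×1) = ū_P`, `W̄(2×1) = W̄(1×2)`).
* `creutzRatio_two_two_pos_of_bounds`, `CreutzRatioPos_two_two_of_windows`: upper ends `b₁₁ ≥ ū_P`, `b₂₂ ≥ W̄(2×2)`, a lower
  end `a₁₂ ≤ W̄(1×2)`, positive lower ends, and the exact test `b₂₂ · b₁₁ < a₁₂²` ⇒ `χ(2,2) > 0` — THE Q-A1 SIGN TEST.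
* `le_creutzRatio_two_two_of_bounds`, `creutzRatio_two_two_le_of_bounds`, `CreutzRatioWindow_two_two_of_windows`:
  the two-sided bracket `log (a₁₂²/(b₂₂ b₁₁)) ≤ χ(2,2) ≤ log (b₁₂²/(a₂₂ a₁₁))`.
* `amgm_of_linear_pos`, `creutzRatio_two_two_pos_of_linear`, `CreutzRatioPos_two_two_of_linear` — THE CERTIFIER'S (S+) SHAPE
  (`pub/ym-instrument/ym-instrument-boot-cert-1/CHI22-CERT-SHAPE.md` §1): ONE certified linear functional
  `ℓ_c = W̄(1×2) − (c/2)·W̄(2×2) − (1/(2c))·ū_P > 0` (some rational `c > 0`) ⇒ `χ(2,2) > 0` by AM–GM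
  (`β_std ≥ 0`, even `L ≥ 4`); `wilsonLoopExpectation_one_two_sq_le_plaquette` (`W̄(1×2)² ≤ ū_P`, link minor).
* `wilsonLoopExpectation_one_two_sq_le` (`W̄(1×2)² ≤ W̄(2×2)`), `plaquetteExpectation_sq_le_wilsonLoopExpectation_one_two`
  (`ū_P² ≤ W̄(1×2)`): site-reflection Gram minors of the tree (Osterwalder–Seiler 1978 §2 via
  `GaugeBoot.wilsonLoopExpectation_sq_le_even`), even `L ≥ 2`, any real `β_std`; hence
  `creutzRatio_two_two_le_neg_log_plaquette`: `χ(2,2) ≤ −log ū_P` whenever `ū_P > 0`, and with a certified plaquette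
  lower end `a > 0`, `χ(2,2) ≤ −log a` (`creutzRatio_two_two_le_of_plaquetteWindow`). Reflection positivity does NOT
  sign χ(2,2) (it is a mixed second difference of `log W̄`); the sign is exactly what Q-A1's certificates must decide.

References: M. Creutz, Phys. Rev. D 21 (1980) 2308 (χ); K. Osterwalder, E. Seiler, Ann. Phys. 110 (1978) 440, §2;
E. Seiler, LNP 159 (1982) §2 (reflection positivity of the Wilson action); C. Bachas, Phys. Rev. D 33 (1986) 2723
(RP convexity statements for Wilson loops).
-/

noncomputable section

namespace Summit.QuantumFields.YangMills.Theorems.Instrument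

open Summit.QuantumFields.GaugeBoot

variable {N D : ℕ}

/-! ## χ(2,2) in terms of the plaquette, `W̄(1×2)` and `W̄(2×2)` -/

/-- `χ(2,2) = −log ( W̄(2×2) · ū_P / W̄(1×2)² )` (`W̄(1×1) = ū_P`, `W̄(2×1) = W̄(1×2)` for `D ≥ 2`). -/
theorem creutzRatio_two_two (hD : 2 ≤ D) (L : ℕ) [NeZero L] (β : ℝ) :
    creutzRatio N D L β 2 2 =
      -Real.log (wilsonLoopExpectation N D L β 2 2 * plaquetteExpectation N D L β /
        wilsonLoopExpectation N D L β 1 2 ^ 2) := by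
  rw [creutzRatio_def, show (2 - 1 : ℕ) = 1 from rfl, wilsonLoopExpectation_one_one,
    wilsonLoopExpectation_comm hD L β 2 1, sq]

/-- The AM–GM step of the (S+) shape, as pure real arithmetic: `0 < w₁₂ − (c/2)·w₂₂ − (1/(2c))·u` with `c > 0`,
`u, w₂₂ ≥ 0` forces `u·w₂₂ < w₁₂²` and `w₁₂ > 0` (since `((c/2)·w₂₂ + u/(2c))² = ((c/2)·w₂₂ − u/(2c))² + u·w₂₂`). -/
theorem amgm_of_linear_pos {u w₁₂ w₂₂ c : ℝ} (hc : 0 < c) (hu : 0 ≤ u) (hw : 0 ≤ w₂₂)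
    (hℓ : 0 < w₁₂ - c / 2 * w₂₂ - 1 / (2 * c) * u) : u * w₂₂ < w₁₂ ^ 2 ∧ 0 < w₁₂ := by
  have hA0 : 0 ≤ c / 2 * w₂₂ + 1 / (2 * c) * u :=
    add_nonneg (mul_nonneg (by positivity) hw) (mul_nonneg (by positivity) hu)
  have hA : c / 2 * w₂₂ + 1 / (2 * c) * u < w₁₂ := by linarith
  have hxy : (c / 2 * w₂₂ + 1 / (2 * c) * u) ^ 2 = (c / 2 * w₂₂ - 1 / (2 * c) * u) ^ 2 + u * w₂₂ := by
    field_simp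
    ring
  refine ⟨?_, hA0.trans_lt hA⟩
  calc u * w₂₂ ≤ (c / 2 * w₂₂ + 1 / (2 * c) * u) ^ 2 := by
        rw [hxy]; nlinarith [sq_nonneg (c / 2 * w₂₂ - 1 / (2 * c) * u)]
    _ < w₁₂ ^ 2 := pow_lt_pow_left₀ hA hA0 two_ne_zero

/-! ## Pointwise (fixed torus) consequences of bounds on the three expectations -/

section Pointwise

variable (hD : 2 ≤ D) (L : ℕ) [NeZero L] (β : ℝ)
include hD

/-- **Sign from bounds** (fixed torus): if `ū_P ≤ b₁₁`, `a₁₂ ≤ W̄(1×2)`, `W̄(2×2) ≤ b₂₂` with `ū_P > 0`, `W̄(2×2) > 0`,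
`a₁₂ > 0` and the exact-arithmetic test `b₂₂ · b₁₁ < a₁₂²` passes, then `χ(2,2) > 0`. -/
theorem creutzRatio_two_two_pos_of_bounds {a₁₂ b₁₁ b₂₂ : ℝ}
    (h₁₁ : plaquetteExpectation N D L β ≤ b₁₁) (h₁₂ : a₁₂ ≤ wilsonLoopExpectation N D L β 1 2)
    (h₂₂ : wilsonLoopExpectation N D L β 2 2 ≤ b₂₂) (hp₁₁ : 0 < plaquetteExpectation N D L β)
    (hp₂₂ : 0 < wilsonLoopExpectation N D L β 2 2) (ha₁₂ : 0 < a₁₂) (htest : b₂₂ * b₁₁ < a₁₂ ^ 2) :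
    0 < creutzRatio N D L β 2 2 := by
  rw [creutzRatio_two_two hD L β, neg_pos]
  have h12pos : 0 < wilsonLoopExpectation N D L β 1 2 := ha₁₂.trans_le h₁₂
  have hnum : 0 < wilsonLoopExpectation N D L β 2 2 * plaquetteExpectation N D L β := mul_pos hp₂₂ hp₁₁
  have hden : 0 < wilsonLoopExpectation N D L β 1 2 ^ 2 := pow_pos h12pos 2
  refine Real.log_neg (div_pos hnum hden) ((div_lt_one hden).mpr ?_)
  calc wilsonLoopExpectation N D L β 2 2 * plaquetteExpectation N D L β
      ≤ b₂₂ * b₁₁ := mul_le_mul h₂₂ h₁₁ hp₁₁.le (hp₂₂.le.trans h₂₂)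
    _ < a₁₂ ^ 2 := htest
    _ ≤ wilsonLoopExpectation N D L β 1 2 ^ 2 := pow_le_pow_left₀ ha₁₂.le h₁₂ 2

/-- **Lower end of the bracket** (fixed torus): `log (a₁₂² / (b₂₂ b₁₁)) ≤ χ(2,2)` from `ū_P ≤ b₁₁`,
`a₁₂ ≤ W̄(1×2)`, `W̄(2×2) ≤ b₂₂` (`ū_P, W̄(2×2), a₁₂ > 0`). -/
theorem le_creutzRatio_two_two_of_bounds {a₁₂ b₁₁ b₂₂ : ℝ}
    (h₁₁ : plaquetteExpectation N D L β ≤ b₁₁) (h₁₂ : a₁₂ ≤ wilsonLoopExpectation N D L β 1 2)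
    (h₂₂ : wilsonLoopExpectation N D L β 2 2 ≤ b₂₂) (hp₁₁ : 0 < plaquetteExpectation N D L β)
    (hp₂₂ : 0 < wilsonLoopExpectation N D L β 2 2) (ha₁₂ : 0 < a₁₂) :
    Real.log (a₁₂ ^ 2 / (b₂₂ * b₁₁)) ≤ creutzRatio N D L β 2 2 := by
  rw [creutzRatio_two_two hD L β, ← Real.log_inv, inv_div]
  have h12pos : 0 < wilsonLoopExpectation N D L β 1 2 := ha₁₂.trans_le h₁₂
  have hnum : 0 < wilsonLoopExpectation N D L β 2 2 * plaquetteExpectation N D L β := mul_pos hp₂₂ hp₁₁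
  have hbb : 0 < b₂₂ * b₁₁ := mul_pos (hp₂₂.trans_le h₂₂) (hp₁₁.trans_le h₁₁)
  refine Real.log_le_log (div_pos (pow_pos ha₁₂ 2) hbb) ?_
  exact div_le_div₀ (sq_nonneg _) (pow_le_pow_left₀ ha₁₂.le h₁₂ 2) hnum
    (mul_le_mul h₂₂ h₁₁ hp₁₁.le (hp₂₂.le.trans h₂₂))

/-- **Upper end of the bracket** (fixed torus): `χ(2,2) ≤ log (b₁₂² / (a₂₂ a₁₁))` from `a₁₁ ≤ ū_P`,
`W̄(1×2) ≤ b₁₂`, `a₂₂ ≤ W̄(2×2)` (`a₁₁, a₂₂ > 0`, `W̄(1×2) > 0`). -/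
theorem creutzRatio_two_two_le_of_bounds {a₁₁ a₂₂ b₁₂ : ℝ}
    (h₁₁ : a₁₁ ≤ plaquetteExpectation N D L β) (h₁₂ : wilsonLoopExpectation N D L β 1 2 ≤ b₁₂)
    (h₂₂ : a₂₂ ≤ wilsonLoopExpectation N D L β 2 2) (ha₁₁ : 0 < a₁₁) (ha₂₂ : 0 < a₂₂)
    (hp₁₂ : 0 < wilsonLoopExpectation N D L β 1 2) :
    creutzRatio N D L β 2 2 ≤ Real.log (b₁₂ ^ 2 / (a₂₂ * a₁₁)) := by
  rw [creutzRatio_two_two hD L β, ← Real.log_inv, inv_div]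
  have hnum : 0 < wilsonLoopExpectation N D L β 2 2 * plaquetteExpectation N D L β :=
    mul_pos (ha₂₂.trans_le h₂₂) (ha₁₁.trans_le h₁₁)
  refine Real.log_le_log (div_pos (pow_pos hp₁₂ 2) hnum) ?_
  exact div_le_div₀ (sq_nonneg _) (pow_le_pow_left₀ hp₁₂.le h₁₂ 2) (mul_pos ha₂₂ ha₁₁)
    (mul_le_mul h₂₂ h₁₁ ha₁₁.le ((ha₂₂.trans_le h₂₂).le))

/-! ## What reflection positivity alone gives: `χ(2,2) ≤ −log ū_P` -/

/-- `W̄(1×2)² ≤ W̄(2×2)` on every even torus with `L ≥ 2` (site-reflection Gram minor `W̄((1+1)×2)·W̄(0×2) ≥ W̄(1×2)²`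
with `W̄(0×2) ≤ 1`, `W̄(2×2) ≥ 0`; any real `β_std`). -/
theorem wilsonLoopExpectation_one_two_sq_le (hL : Even L) (h2 : 2 ≤ L) :
    wilsonLoopExpectation N D L β 1 2 ^ 2 ≤ wilsonLoopExpectation N D L β 2 2 := by
  have hL2 : 1 ≤ L / 2 := by omega
  have h := wilsonLoopExpectation_sq_le_even (N := N) hD L hL β (a := 1) (b := 0) hL2 (Nat.zero_le _) 2
  have h22 : 0 ≤ wilsonLoopExpectation N D L β 2 2 :=
    wilsonLoopExpectation_nonneg_even (N := N) hD L hL β (a := 1) hL2 2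
  have h02 : wilsonLoopExpectation N D L β (0 + 0) 2 ≤ 1 :=
    (abs_le.mp (abs_wilsonLoopExpectation_le_one (N := N) hD L β (0 + 0) 2)).2
  calc wilsonLoopExpectation N D L β 1 2 ^ 2
      ≤ wilsonLoopExpectation N D L β (1 + 1) 2 * wilsonLoopExpectation N D L β (0 + 0) 2 := h
    _ ≤ wilsonLoopExpectation N D L β (1 + 1) 2 * 1 := mul_le_mul_of_nonneg_left h02 h22
    _ = wilsonLoopExpectation N D L β 2 2 := mul_one _

/-- `ū_P² ≤ W̄(1×2)` on every even torus with `L ≥ 2` (site-reflection Gram minor in the other direction,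
`W̄(2×1)·W̄(0×1) ≥ W̄(1×1)²`, `W̄(2×1) = W̄(1×2)`; any real `β_std`). -/
theorem plaquetteExpectation_sq_le_wilsonLoopExpectation_one_two (hL : Even L) (h2 : 2 ≤ L) :
    plaquetteExpectation N D L β ^ 2 ≤ wilsonLoopExpectation N D L β 1 2 := by
  have hL2 : 1 ≤ L / 2 := by omega
  have h := wilsonLoopExpectation_sq_le_even (N := N) hD L hL β (a := 1) (b := 0) hL2 (Nat.zero_le _) 1
  have h21 : 0 ≤ wilsonLoopExpectation N D L β 2 1 :=
    wilsonLoopExpectation_nonneg_even (N := N) hD L hL β (a := 1) hL2 1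
  have h01 : wilsonLoopExpectation N D L β (0 + 0) 1 ≤ 1 :=
    (abs_le.mp (abs_wilsonLoopExpectation_le_one (N := N) hD L β (0 + 0) 1)).2
  rw [← wilsonLoopExpectation_one_one, wilsonLoopExpectation_comm hD L β 1 2]
  calc wilsonLoopExpectation N D L β 1 1 ^ 2
      ≤ wilsonLoopExpectation N D L β (1 + 1) 1 * wilsonLoopExpectation N D L β (0 + 0) 1 := h
    _ ≤ wilsonLoopExpectation N D L β (1 + 1) 1 * 1 := mul_le_mul_of_nonneg_left h01 h21
    _ = wilsonLoopExpectation N D L β 2 1 := mul_one _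

/-- **Reflection positivity alone bounds χ(2,2) from ABOVE by `−log ū_P`** on every even torus `L ≥ 2` whenever
`ū_P > 0`: `W̄(2×2) ≥ W̄(1×2)²` gives `W̄(2×2) ū_P / W̄(1×2)² ≥ ū_P`. (It does NOT sign χ(2,2): the sign is Q-A1's
question and needs certified two-sided windows.) -/
theorem creutzRatio_two_two_le_neg_log_plaquette (hL : Even L) (h2 : 2 ≤ L)
    (hp : 0 < plaquetteExpectation N D L β) :
    creutzRatio N D L β 2 2 ≤ -Real.log (plaquetteExpectation N D L β) := by
  rw [creutzRatio_two_two hD L β, neg_le_neg_iff]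
  have h12 : 0 < wilsonLoopExpectation N D L β 1 2 :=
    (pow_pos hp 2).trans_le (plaquetteExpectation_sq_le_wilsonLoopExpectation_one_two hD L β hL h2)
  have hden : 0 < wilsonLoopExpectation N D L β 1 2 ^ 2 := pow_pos h12 2
  refine Real.log_le_log hp ?_
  rw [le_div_iff₀ hden]
  calc plaquetteExpectation N D L β * wilsonLoopExpectation N D L β 1 2 ^ 2
      ≤ plaquetteExpectation N D L β * wilsonLoopExpectation N D L β 2 2 :=
        mul_le_mul_of_nonneg_left (wilsonLoopExpectation_one_two_sq_le hD L β hL h2) hp.le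
    _ = wilsonLoopExpectation N D L β 2 2 * plaquetteExpectation N D L β := mul_comm _ _

/-- Corollary with a certified plaquette lower end `0 < a ≤ ū_P`: `χ(2,2) ≤ −log a`. -/
theorem creutzRatio_two_two_le_neg_log_of_le (hL : Even L) (h2 : 2 ≤ L) {a : ℝ} (ha : 0 < a)
    (h : a ≤ plaquetteExpectation N D L β) : creutzRatio N D L β 2 2 ≤ -Real.log a :=
  (creutzRatio_two_two_le_neg_log_plaquette hD L β hL h2 (ha.trans_le h)).trans
    (neg_le_neg (Real.log_le_log ha h))


/-! ### The certifier's (S+) shape (`pub/ym-instrument/ym-instrument-boot-cert-1/CHI22-CERT-SHAPE.md` §1): ONE linear functional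
`ℓ_c = W̄(1×2) − (c/2)·W̄(2×2) − (1/(2c))·ū_P` certified positive ⇒ χ(2,2) > 0 by AM–GM -/

/-- `W̄(1×2)² ≤ ū_P` on every even torus `L ≥ 4` at `β_std ≥ 0` (link-reflection Gram minor `W̄(2×1)² ≤ W̄(1×1)·W̄(3×1)` of the
tree, `W̄(3×1) ≤ 1`, `W̄(1×1) ≥ 0`, and `W̄(2×1) = W̄(1×2)`). -/
theorem wilsonLoopExpectation_one_two_sq_le_plaquette (hL : Even L) (h4 : 4 ≤ L) (hβ : 0 ≤ β) :
    wilsonLoopExpectation N D L β 1 2 ^ 2 ≤ plaquetteExpectation N D L β := by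
  have ha : 0 + 1 ≤ L / 2 := by omega
  have hb : 1 + 1 ≤ L / 2 := by omega
  have h := wilsonLoopExpectation_sq_le_odd (N := N) hD L hL hβ (a := 0) (b := 1) ha hb 1
  have h11 : 0 ≤ wilsonLoopExpectation N D L β (0 + 0 + 1) 1 :=
    wilsonLoopExpectation_nonneg_odd (N := N) hD L hL hβ (a := 0) ha 1
  have h31 : wilsonLoopExpectation N D L β (1 + 1 + 1) 1 ≤ 1 :=
    (abs_le.mp (abs_wilsonLoopExpectation_le_one (N := N) hD L β (1 + 1 + 1) 1)).2
  rw [wilsonLoopExpectation_comm hD L β 1 2, ← wilsonLoopExpectation_one_one]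
  calc wilsonLoopExpectation N D L β 2 1 ^ 2
      = wilsonLoopExpectation N D L β (0 + 1 + 1) 1 ^ 2 := by norm_num
    _ ≤ wilsonLoopExpectation N D L β (0 + 0 + 1) 1 * wilsonLoopExpectation N D L β (1 + 1 + 1) 1 := h
    _ ≤ wilsonLoopExpectation N D L β (0 + 0 + 1) 1 * 1 := mul_le_mul_of_nonneg_left h31 h11
    _ = wilsonLoopExpectation N D L β 1 1 := by norm_num

/-- **(S+) ⇒ sign** (fixed torus): if for some `c > 0` the linear functional
`ℓ_c = W̄(1×2) − (c/2)·W̄(2×2) − (1/(2c))·ū_P` is positive on the torus state (`0 < ℓ_c`), then `χ(2,2) > 0`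
(even `L ≥ 4`, `β_std ≥ 0`, `D ≥ 2`). Proof: `W̄(1×2) > (c·W̄(2×2) + ū_P/c)/2 ≥ √(ū_P·W̄(2×2))` (AM–GM; `ū_P, W̄(2×2) ≥ 0` by
reflection positivity), so `W̄(1×2)² > ū_P·W̄(2×2)`; and `ū_P ≥ W̄(1×2)² > 0`, `W̄(2×2) ≥ W̄(1×2)² > 0` make the ratio positive.
This is the typist's half of the certifier's shape: a certificate delivers exactly the hypothesis `hℓ`. -/
theorem creutzRatio_two_two_pos_of_linear (hL : Even L) (h4 : 4 ≤ L) (hβ : 0 ≤ β) {c : ℝ} (hc : 0 < c)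
    (hℓ : 0 < wilsonLoopExpectation N D L β 1 2 - c / 2 * wilsonLoopExpectation N D L β 2 2 -
      1 / (2 * c) * plaquetteExpectation N D L β) :
    0 < creutzRatio N D L β 2 2 := by
  have h2 : 2 ≤ L := le_trans (by norm_num) h4
  have hw0 : 0 ≤ wilsonLoopExpectation N D L β 2 2 :=
    wilsonLoopExpectation_nonneg_even (N := N) hD L hL β (a := 1) (by omega) 2
  obtain ⟨hsq, h12pos⟩ := amgm_of_linear_pos hc (plaquetteExpectation_nonneg hD L hL hβ) hw0 hℓ
  have hupos : 0 < plaquetteExpectation N D L β :=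
    (pow_pos h12pos 2).trans_le (wilsonLoopExpectation_one_two_sq_le_plaquette hD L β hL h4 hβ)
  have hwpos : 0 < wilsonLoopExpectation N D L β 2 2 :=
    (pow_pos h12pos 2).trans_le (wilsonLoopExpectation_one_two_sq_le hD L β hL h2)
  rw [creutzRatio_two_two hD L β, neg_pos]
  refine Real.log_neg (div_pos (mul_pos hwpos hupos) (pow_pos h12pos 2))
    ((div_lt_one (pow_pos h12pos 2)).mpr ?_)
  rw [mul_comm]
  exact hsq

end Pointwise

/-! ## Window forms (shape (A) of the inherited cell ⇒ instrument target shapes) -/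

/-- **Q-A1 glue, sign**: certified windows `ū_P ∈ [a₁₁, b₁₁]` (from `L₁`), `W̄(1×2) ∈ [a₁₂, b₁₂]` (from `L₂`),
`W̄(2×2) ∈ [a₂₂, b₂₂]` (from `L₃`) with positive lower ends and the exact-arithmetic test `b₂₂ · b₁₁ < a₁₂²`
give `χ(2,2) > 0` on every even torus `L ≥ max L₁ (max L₂ L₃)`. -/
theorem CreutzRatioPos_two_two_of_windows (hD : 2 ≤ D) {L₁ L₂ L₃ : ℕ} {β a₁₁ b₁₁ a₁₂ b₁₂ a₂₂ b₂₂ : ℝ}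
    (h₁₁ : PlaquetteWindow N D L₁ β a₁₁ b₁₁) (h₁₂ : WilsonLoopWindow N D L₂ β 1 2 a₁₂ b₁₂)
    (h₂₂ : WilsonLoopWindow N D L₃ β 2 2 a₂₂ b₂₂) (ha₁₁ : 0 < a₁₁) (ha₁₂ : 0 < a₁₂) (ha₂₂ : 0 < a₂₂)
    (htest : b₂₂ * b₁₁ < a₁₂ ^ 2) :
    CreutzRatioPos N D (max L₁ (max L₂ L₃)) β 2 2 := by
  intro L _ hL hL₀
  obtain ⟨hl₁₁, hu₁₁⟩ := h₁₁ L hL (le_trans (le_max_left _ _) hL₀)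
  obtain ⟨hl₁₂, -⟩ := h₁₂ L hL (le_trans ((le_max_left _ _).trans (le_max_right _ _)) hL₀)
  obtain ⟨hl₂₂, hu₂₂⟩ := h₂₂ L hL (le_trans ((le_max_right _ _).trans (le_max_right _ _)) hL₀)
  exact creutzRatio_two_two_pos_of_bounds hD L β hu₁₁ hl₁₂ hu₂₂ (ha₁₁.trans_le hl₁₁) (ha₂₂.trans_le hl₂₂)
    ha₁₂ htest

/-- **Q-A1 glue, two-sided bracket**: the same three certified windows give
`log (a₁₂² / (b₂₂ b₁₁)) ≤ χ(2,2) ≤ log (b₁₂² / (a₂₂ a₁₁))` on every even torus `L ≥ max L₁ (max L₂ L₃)`. -/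
theorem CreutzRatioWindow_two_two_of_windows (hD : 2 ≤ D) {L₁ L₂ L₃ : ℕ} {β a₁₁ b₁₁ a₁₂ b₁₂ a₂₂ b₂₂ : ℝ}
    (h₁₁ : PlaquetteWindow N D L₁ β a₁₁ b₁₁) (h₁₂ : WilsonLoopWindow N D L₂ β 1 2 a₁₂ b₁₂)
    (h₂₂ : WilsonLoopWindow N D L₃ β 2 2 a₂₂ b₂₂) (ha₁₁ : 0 < a₁₁) (ha₁₂ : 0 < a₁₂) (ha₂₂ : 0 < a₂₂) :
    CreutzRatioWindow N D (max L₁ (max L₂ L₃)) β 2 2 (Real.log (a₁₂ ^ 2 / (b₂₂ * b₁₁)))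
      (Real.log (b₁₂ ^ 2 / (a₂₂ * a₁₁))) := by
  intro L _ hL hL₀
  obtain ⟨hl₁₁, hu₁₁⟩ := h₁₁ L hL (le_trans (le_max_left _ _) hL₀)
  obtain ⟨hl₁₂, hu₁₂⟩ := h₁₂ L hL (le_trans ((le_max_left _ _).trans (le_max_right _ _)) hL₀)
  obtain ⟨hl₂₂, hu₂₂⟩ := h₂₂ L hL (le_trans ((le_max_right _ _).trans (le_max_right _ _)) hL₀)
  exact ⟨le_creutzRatio_two_two_of_bounds hD L β hu₁₁ hl₁₂ hu₂₂ (ha₁₁.trans_le hl₁₁) (ha₂₂.trans_le hl₂₂) ha₁₂,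
    creutzRatio_two_two_le_of_bounds hD L β hl₁₁ hu₁₂ hl₂₂ ha₁₁ ha₂₂ (ha₁₂.trans_le hl₁₂)⟩

/-- **RP-only upper bracket from a plaquette window**: `a ≤ ū_P` (`a > 0`) for even `L ≥ L₀` gives
`χ(2,2) ≤ −log a` for even `L ≥ max L₀ 2`. -/
theorem creutzRatio_two_two_le_of_plaquetteWindow (hD : 2 ≤ D) {L₀ : ℕ} {β a b : ℝ}
    (h : PlaquetteWindow N D L₀ β a b) (ha : 0 < a) (L : ℕ) [NeZero L] (hL : Even L) (hL₀ : max L₀ 2 ≤ L) :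
    creutzRatio N D L β 2 2 ≤ -Real.log a :=
  creutzRatio_two_two_le_neg_log_of_le hD L β hL (le_trans (le_max_right _ _) hL₀) ha
    (h L hL (le_trans (le_max_left _ _) hL₀)).1


/-- **(S+) in window form**: a certified bound `g ≤ ℓ_c` with `g > 0`, `c > 0`, valid on every even torus `L ≥ L₀` (the
certificate's torus clause) at `β_std ≥ 0`, gives `CreutzRatioPos N D (max L₀ 4) β 2 2`. -/
theorem CreutzRatioPos_two_two_of_linear (hD : 2 ≤ D) {L₀ : ℕ} {β c g : ℝ} (hβ : 0 ≤ β) (hc : 0 < c) (hg : 0 < g)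
    (hℓ : ∀ (L : ℕ) [NeZero L], Even L → L₀ ≤ L →
      g ≤ wilsonLoopExpectation N D L β 1 2 - c / 2 * wilsonLoopExpectation N D L β 2 2 -
        1 / (2 * c) * plaquetteExpectation N D L β) :
    CreutzRatioPos N D (max L₀ 4) β 2 2 := by
  intro L _ hL hL₀
  exact creutzRatio_two_two_pos_of_linear hD L β hL (le_trans (le_max_right _ _) hL₀) hβ hc
    (hg.trans_le (hℓ L hL (le_trans (le_max_left _ _) hL₀)))


/-! ## Appendix (gen 0, after the certifier's interface): the (S+) functional with INTEGER coefficients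

The kernel emitter of record for the kz-L2-rp-4D certificates requires integer objective coefficients, so a chi22 END is
registered as `2pq·W̄(1×2) − p²·W̄(2×2) − q²·ū_P` for `c = p/q` (`= 2pq·ℓ_c`). -/

/-- **(S+) ⇒ sign, integer-scaled functional** (fixed torus): `0 < 2pq·W̄(1×2) − p²·W̄(2×2) − q²·ū_P` with `p, q > 0`
(i.e. `2pq·ℓ_{p/q} > 0`) gives `χ(2,2) > 0` (`D ≥ 2`, even `L ≥ 4`, `β_std ≥ 0`). -/
theorem creutzRatio_two_two_pos_of_linear_int {N D : ℕ} (hD : 2 ≤ D) (L : ℕ) [NeZero L] (β : ℝ) (hL : Even L)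
    (h4 : 4 ≤ L) (hβ : 0 ≤ β) {p q : ℝ} (hp : 0 < p) (hq : 0 < q)
    (hℓ : 0 < 2 * p * q * wilsonLoopExpectation N D L β 1 2 - p ^ 2 * wilsonLoopExpectation N D L β 2 2 -
      q ^ 2 * plaquetteExpectation N D L β) :
    0 < creutzRatio N D L β 2 2 := by
  refine creutzRatio_two_two_pos_of_linear hD L β hL h4 hβ (c := p / q) (div_pos hp hq) ?_
  have h2pq : 0 < 2 * p * q := by positivity
  have key : wilsonLoopExpectation N D L β 1 2 - p / q / 2 * wilsonLoopExpectation N D L β 2 2 -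
      1 / (2 * (p / q)) * plaquetteExpectation N D L β =
      (2 * p * q * wilsonLoopExpectation N D L β 1 2 - p ^ 2 * wilsonLoopExpectation N D L β 2 2 -
        q ^ 2 * plaquetteExpectation N D L β) / (2 * p * q) := by
    field_simp
  rw [key]
  exact div_pos hℓ h2pq

/-- **(S+) in window form, integer-scaled**: a certified bound `g ≤ 2pq·W̄(1×2) − p²·W̄(2×2) − q²·ū_P` with `g > 0`, `p, q > 0`,
valid on every even torus `L ≥ L₀` at `β_std ≥ 0`, gives `CreutzRatioPos N D (max L₀ 4) β 2 2`. -/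
theorem CreutzRatioPos_two_two_of_linear_int {N D : ℕ} (hD : 2 ≤ D) {L₀ : ℕ} {β p q g : ℝ} (hβ : 0 ≤ β)
    (hp : 0 < p) (hq : 0 < q) (hg : 0 < g)
    (hℓ : ∀ (L : ℕ) [NeZero L], Even L → L₀ ≤ L →
      g ≤ 2 * p * q * wilsonLoopExpectation N D L β 1 2 - p ^ 2 * wilsonLoopExpectation N D L β 2 2 -
        q ^ 2 * plaquetteExpectation N D L β) :
    CreutzRatioPos N D (max L₀ 4) β 2 2 := by
  intro L _ hL hL₀
  exact creutzRatio_two_two_pos_of_linear_int hD L β hL (le_trans (le_max_right _ _) hL₀) hβ hp hq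
    (hg.trans_le (hℓ L hL (le_trans (le_max_left _ _) hL₀)))

end Summit.QuantumFields.YangMills.Theorems.Instrument

end
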